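/- Copyright: the b2b-balaban cell (near-miss cell 7), T⁴-continuum fan-out, ROUND-2 swarm `t4-ne7b-formalise-*`
(leaf 08), row NE7b (node U5c COUNT member).  Released under the licence of the surrounding project. -/
import Summits.QuantumFields.BalabanUV.T4Continuum.Support.HistoryRealise
import Summits.QuantumFields.BalabanUV.T4Continuum.Support.HistoryGenBridge
import Summits.QuantumFields.BalabanUV.T4Continuum.Support.HistoryBankingLE

/-!
# Realised histories are `ConsistentTLE` and pending: the socket's timing fields FROM THE GEOMETRY
(swarm row S1b «H1b geometric layer», part 3: the junction with the pedigree and the LE-consistency)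

Summits-side support leaf of the T⁴-continuum cell (rung (B)+1 on a FINITE torus only; NOT infinite volume, NOT the
mass gap, NOT the Clay statement; NOT a proof of the spine estimate NE7b).  Row S1b of the swarm claim table
`t4/b2b-balaban-t4-ne7b-p1/LEAVES-NE7b.md` (parts 1–2: `HistoryWindows` p208941, `HistoryRealise` p209120).
[folklore] bookkeeping over the lineage's OWN carriers; nothing printed is asserted; no `[cite:]` tag; no `def … :
Prop` fact of print (c1) — no `def` at all.

WHY.  The socket of record (`HistorySocketTH.LiveHistoriesTH`, ruling R-OWNER-22-1 R2) asks per live member the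
timing fields `consistent` and `pending`; rows S3∕S4 deliver them from DISPLAYED timing hypotheses on the pedigree
(`HistoryGenTimed.Pedigree.Timed`: `alive`, `renew_reach`, …), and row S4c (`HistoryBankingLE`, ruling R-OWNER-22-6)
replaces `ConsistentT`'s renewal EQUALITY by `ConsistentTLE`'s `h + 1 ≤ reach`.  Parts 1–2 of this row proved that a
REALISED history (regions, `S`-orbits, first readiness, touching joins) stops strictly inside its booked life.  THIS
PART draws the consequence the assembly can plug BY NAME: **a realised history's label is `ConsistentTLE` and pending
— with NO timing hypothesis displayed** (`Adm`, `JoinInLife`∕`alive`, the `≤`-half of `RenewAtReach` all come from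
the geometry; only the EQUALITY half of `RenewAtReach`, which `ConsistentTLE` no longer asks, is left behind).

WHAT.  §1 `consistentTLE_gmap_iff` (LE-consistency transports along a relabelling: `ConsistentTLE sh … G ↔
ConsistentTLE id … (gmap sh G)`).  §2 **`consistentTLE_toGen_of_realises`**: `Realises L s R P Z → P.lastStep ≤ K →
ConsistentTLE id C K R P.toGen` (flat label; hyps of part 2's main theorem: `4 ≤ L`, `∀ m, DropCtl s m`, `∀ t, 1 ≤ R t`,
`13 ≤ C.n₁`).  §3 ON THE PEDIGREE (leaf-09's `HistoryGen.Pedigree`, bridge `HistoryGenBridge.Pedigree.toPGen` with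
`toGen_toPGen`): for a component `c` whose `PGen` is realised, **`consistentTLE_genT_of_realises`** (`ConsistentTLE
Prod.fst C K R (P.genT c)` — the v3 socket's member field in its S4c form) and **`lt_reach_genT_of_pendingAt`**
(`K < (P.genT c).reach (dictWT Prod.fst R C.n₁)` — the field `pending`), given only `renew_step` (renewed parts come
from the previous step — a convention of the pedigree encoding, R-OWNER-22-4) and `lastStep ≤ K`.

HONEST.  Junction lemmas; NE7b NOT proved; spine 0∕9.  HONEST DEPENDENCY (cell): continuum YM on T⁴ ⇐ BetaPertH ∧ nine
spine estimates (0/9 proved); BetaPertH ⇐ (D1) ∧ (D4) ∧ CAP+tail; G-an2-4 gates asym, D1 and NE2/3/4.  This file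
changes none of it. -/

open Finset
open Literature.MathematicalPhysics.QuantumFieldTheory.Balaban1983to89
open Literature.MathematicalPhysics.QuantumFieldTheory.Balaban1983to89.B13ScaleTransfer
open T4PersistenceDictionary T4TaggedShapeBanking
open Summit.QuantumFields.BalabanUV.T4Continuum.ZoneSkeleton
open Summit.QuantumFields.BalabanUV.T4Continuum.HistoryAdmissible
open Summit.QuantumFields.BalabanUV.T4Continuum.HistoryBankingLE
open Summit.QuantumFields.BalabanUV.T4Continuum.HistoryGen

namespace Summit.QuantumFields.BalabanUV.T4Continuum.HistoryRealise

/-! ## §1 LE-consistency transports along a relabelling -/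

/-- **`ConsistentTLE` ALONG `gmap`**: reading the labels of `G` through `sh` is reading the labels of `gmap sh G`
through `id` (steps, readiness indices, root steps and reaches against `dictW ∘ sh` are unchanged). [folklore] -/
theorem consistentTLE_gmap_iff {ε : Type*} (sh : ε → PEv) (C : T4PrintedShapeBanking.Consts) (K : ℕ) (R : ℕ → ℕ) :
    ∀ G : Gen ε, ConsistentTLE id C K R (gmap sh G) ↔ ConsistentTLE sh C K R G
  | Gen.born b j => Iff.rfl
  | Gen.renew G e h => by
      simp only [gmap, ConsistentTLE, consistentTLE_gmap_iff sh C K R G, reach_gmap, id]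
      exact Iff.rfl
  | Gen.merge X Y e => by
      simp only [gmap, ConsistentTLE, consistentTLE_gmap_iff sh C K R X, consistentTLE_gmap_iff sh C K R Y, reach_gmap,
        rootStep_gmap, id]
      exact Iff.rfl

/-! ## §2 A realised history's flat label is `ConsistentTLE` -/

section Flat

variable {d : ℕ} {L : ℕ} {s R : ℕ → ℕ} (hL : 4 ≤ L) (hdrop : ∀ m, B16SProfile.DropCtl s m) (hR : ∀ t, 1 ≤ R t)
  (C : T4PrintedShapeBanking.Consts) (hn₁ : 13 ≤ C.n₁)
include hL hdrop hR hn₁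

/-- **THE FLAT LABEL OF A REALISED HISTORY IS `ConsistentTLE`** (shape map `id`; cutoff `K ≥ lastStep`): births at
their step; renewals dated `h + 1 ≤ booked reach` (`renew_lt_reach`) and `≤ K`; joins inside both partners' booked lives
(`lt_reach_of_pendingAt`) after their root steps.  NO timing hypothesis. [folklore] -/
theorem consistentTLE_toGen_of_realises :
    ∀ (P : PGen (Pt d × Finset (Pt d))) (Z : Finset (Pt d)), Realises L s R P Z → ∀ {K : ℕ}, P.lastStep ≤ K →
      ConsistentTLE id C K R P.toGen
  | .birth j cls zZ, Z, _, K, hK => ⟨rfl, rfl, hK⟩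
  | .renew G h, Z, hP, K, hK => by
      have hlt := renew_lt_reach hL hdrop hR hn₁ hP
      obtain ⟨ZG, hG, hready, -, -⟩ := hP
      have hpos := hready.pos
      simp only [PGen.lastStep] at hK
      refine ⟨consistentTLE_toGen_of_realises G ZG hG (K := K) (by omega), rfl, rfl, ?_, hK⟩
      show h + 1 ≤ G.toGen.reach (dictW R C.n₁)
      omega
  | .join X Y sj, Z, hP, K, hK => by
      obtain ⟨ZX, ZY, hX, hY, htX, htY, hpX, hpY, -, -⟩ := hP
      simp only [PGen.lastStep] at hK
      have hrX := lt_reach_of_pendingAt hL hdrop hR hn₁ hX hpX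
      have hrY := lt_reach_of_pendingAt hL hdrop hR hn₁ hY hpY
      have haX := (adm_of_realises X ZX hX htX).rootStep_le_lastStep
      have haY := (adm_of_realises Y ZY hY htY).rootStep_le_lastStep
      refine ⟨consistentTLE_toGen_of_realises X ZX hX (htX.trans hK),
        consistentTLE_toGen_of_realises Y ZY hY (htY.trans hK), rfl, ?_, ?_, ?_, ?_, hK⟩
      · show X.toGen.rootStep ≤ sj
        rw [PGen.rootStep_toGen]; exact haX.trans htX
      · exact hrX
      · show Y.toGen.rootStep ≤ sj
        rw [PGen.rootStep_toGen]; exact haY.trans htY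
      · exact hrY

end Flat

/-! ## §3 On the pedigree: the socket's member fields `consistent` (LE form) and `pending` from the geometry -/

section OnPedigree

variable {d : ℕ} {L : ℕ} {s R : ℕ → ℕ} (hL : 4 ≤ L) (hdrop : ∀ m, B16SProfile.DropCtl s m) (hR : ∀ t, 1 ≤ R t)
  (C : T4PrintedShapeBanking.Consts) (hn₁ : 13 ≤ C.n₁)
variable {α π : Type*} (P : Pedigree α π) (cell : π → Pt d × Finset (Pt d))
  (hS : ∀ c c', Part.old c' true ∈ P.parts c → P.step c' + 1 = P.step c)
include hL hdrop hR hn₁ hS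

/-- **THE TAGGED GENEALOGY OF A REALISED COMPONENT IS `ConsistentTLE`** (shape map `Prod.fst`, the v3 socket's member
field `consistent` in its S4c form): if the component's `PGen` (read off the pedigree with the region payloads) is
realised and its last event is `≤ K`. [folklore] -/
theorem consistentTLE_genT_of_realises {c : α} {Z : Finset (Pt d)} (hc : Realises L s R (P.toPGen cell c) Z) {K : ℕ}
    (hK : (P.toPGen cell c).lastStep ≤ K) : ConsistentTLE Prod.fst C K R (P.genT c) := by
  rw [← consistentTLE_gmap_iff]
  have h := consistentTLE_toGen_of_realises hL hdrop hR C hn₁ _ Z hc hK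
  rwa [P.toGen_toPGen cell hS c] at h

/-- the same for the FLAT genealogy `P.gen c` (shape map `id`) [folklore] -/
theorem consistentTLE_gen_of_realises {c : α} {Z : Finset (Pt d)} (hc : Realises L s R (P.toPGen cell c) Z) {K : ℕ}
    (hK : (P.toPGen cell c).lastStep ≤ K) : ConsistentTLE id C K R (P.gen c) := by
  have h := consistentTLE_toGen_of_realises hL hdrop hR C hn₁ _ Z hc hK
  rwa [P.toGen_toPGen cell hS c] at h

/-- **A REALISED COMPONENT PENDING AT THE CUTOFF IS INSIDE ITS BOOKED LIFE** (the v3 socket's member field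
`pending`, tagged form): `K < (P.genT c).reach (dictWT Prod.fst R C.n₁)`. [folklore] -/
theorem lt_reach_genT_of_pendingAt {c : α} {Z : Finset (Pt d)} (hc : Realises L s R (P.toPGen cell c) Z) {K : ℕ}
    (hK : PendingAt L s R (P.toPGen cell c).lastStep Z K) : K < (P.genT c).reach (dictWT Prod.fst R C.n₁) := by
  have h := lt_reach_of_pendingAt hL hdrop hR hn₁ hc hK
  rw [P.toGen_toPGen cell hS c, Pedigree.reach_gen] at h
  exact h

end OnPedigree

end Summit.QuantumFields.BalabanUV.T4Continuum.HistoryRealise
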